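import Summits.CriticalPhenomena.CardyFormulaZ2.Theorems.CardyFlipRussoVoronoiHubFromSmirnovDefs
import Literature.Analysis.FunctionSpaces.PoissonMeckeProofs

/-!
# Stub `poisson_tupleCount_lintegral_eq` of line `moebius-exact-delaunay-dilation-ward`
# (crux `VoronoiHubFromSmirnov`, stmt-CriticalPhenomena-6433)

The exact first-moment identity behind the defect count of Benjamini–Schramm (I. Benjamini,
O. Schramm, *Conformal invariance of Voronoi percolation*, Comm. Math. Phys. 197 (1998), Lemma 5.2:
the probability that some `m`-tuple of distinct nuclei lies in a measurable `S ⊆ ℂ^m` is at most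
`ν^{⊗m}(S)`): for a Poisson point process `P` on `ℂ` with σ-finite intensity `ν`,

`𝔼_P #{x ∈ c^m : xᵢ pairwise distinct, x ∈ S} = ν^{⊗m}(S)`,

written, as in the tree's multivariate Mecke equation, as the `P`-integral of the `tsum` in `ℝ≥0∞`
over the subtype of injective `x : Fin m → ℂ` with values in the configuration `c` of the indicator
of `S`.  It is the multivariate Mecke equation (G. Last, M. Penrose, *Lectures on the Poisson
Process* (CUP 2017), Thm 4.4; PROVED in tree as
`Literature.Analysis.FunctionSpaces.IsPoissonPointProcess.multivariateMecke_holds`) applied to the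
function `h (x, c) = 1_S (x)`, which does not depend on the configuration: the right-hand side
`∫ 𝔼_P 1_S(x) ν^{⊗m}(dx)` collapses to `ν^{⊗m}(S)` because `P` is a probability measure.

No new definitions.
-/

noncomputable section

namespace Summit.CriticalPhenomena.CardyFormulaZ2.Cruxes.VoronoiHubFromSmirnov.MoebiusExactDelaunayDilationWard

open scoped Topology ENNReal Interval
open Filter Set MeasureTheory
open Literature.Analysis.FunctionSpaces
open Literature.Probability.RandomPlanarGeometry

/-- Integrating a function of the tuple alone against a probability law of configurations and then
against `ν^{⊗m}` is integrating it against `ν^{⊗m}`. [folklore] -/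
theorem tc_lintegral_lintegral_const_eq {m : ℕ} (ν : Measure ℂ) (P : Measure (PointConfig ℂ))
    [IsProbabilityMeasure P] (g : (Fin m → ℂ) → ℝ≥0∞) :
    ∫⁻ x, ∫⁻ _c, g x ∂P ∂(Measure.pi fun _ : Fin m => ν) =
      ∫⁻ x, g x ∂(Measure.pi fun _ : Fin m => ν) := by
  refine lintegral_congr fun x => ?_
  rw [lintegral_const, measure_univ, mul_one]

/-- **First moment of the number of `m`-tuples of distinct Poisson points in a set**
(Benjamini–Schramm 1998, proof of Lemma 5.2; Last–Penrose 2017, Thm 4.4 with `h = 1_S ∘ fst`):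
for a Poisson point process `P` on `ℂ` with σ-finite intensity `ν`, every `m` and every measurable
`S ⊆ ℂ^m`, `𝔼_P #{x ∈ c^m injective : x ∈ S} = ν^{⊗m}(S)`. [cite: LastPenrose2017, Thm 4.4] -/
theorem poisson_tupleCount_lintegral_eq : ∀ {ν : MeasureTheory.Measure ℂ} [MeasureTheory.SigmaFinite ν] {P : MeasureTheory.Measure (Literature.Analysis.FunctionSpaces.PointConfig ℂ)}, Literature.Analysis.FunctionSpaces.IsPoissonPointProcess ν P → ∀ (m : ℕ) (S : Set (Fin m → ℂ)), MeasurableSet S → ∫⁻ c, (∑' x : {x : Fin m → ℂ // Function.Injective x ∧ ∀ i, x i ∈ c}, S.indicator (fun _ => (1 : ENNReal)) x.1) ∂P = (MeasureTheory.Measure.pi fun _ : Fin m => ν) S := by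
  intro ν _ P hP m S hS
  haveI := hP.isProbabilityMeasure
  have hM := @IsPoissonPointProcess.multivariateMecke_holds.{0} ℂ _ _ _ _ _ ν _ P hP m
    (fun p => S.indicator (fun _ => (1 : ℝ≥0∞)) p.1)
    ((measurable_const.indicator hS).comp measurable_fst)
  rw [hM, tc_lintegral_lintegral_const_eq]
  exact lintegral_indicator_one hS

end Summit.CriticalPhenomena.CardyFormulaZ2.Cruxes.VoronoiHubFromSmirnov.MoebiusExactDelaunayDilationWard

end
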